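import Summits.PneNP.PneNP.Theorems.OneSliceConstantBandTransferStepAux

/-!
# Route OneSlice, item `ShallowSliceBound` (stmt-PneNP-14083): a uniform slice graph plus an independent `G(n,p)`

Helper file (prover seat, 2026-08-16), def-free (vocabulary: `Edge`, `slice` of
`Theorems/ConstantBand/Negative/LoadBearing.lean`; `edgeCount`, `gnpWeight` of the Literature). **Leg A, step 2**
of the proof of `ShallowSliceBound`: the law of `H ⊔ y` for `H` uniform on the slice `j'` and `y ∼ G(n,p)`
independent is a mixture of UNIFORM slice laws — every `z` with `|z| = ℓ` has the same weight
`C(ℓ, j') p^{ℓ - j'} (1-p)^{N - ℓ} / #slice_{j'}`: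

* `sum_gnpWeight_sup_eq` — the cylinder sum `Σ_{y : H ⊔ y = z} Pr[y] = [H ⊆ z] p^{|z|-|H|} (1-p)^{N-|z|}`;
* `card_slice_filter_subset_eq` — `#{H ∈ slice_{j'} : H ⊆ z} = C(|z|, j')`;
* `sum_slice_sum_gnpWeight_sup` — `Σ_{H ∈ slice_{j'}} Σ_y Pr[y] F(H ⊔ y) = Σ_z F(z) C(|z|,j') p^{|z|-j'} (1-p)^{N-|z|}`;
* `sum_slice_gnpWeight_edgeCount_sup_gt_le` — Markov: `Σ_H Pr_y[|H ⊔ y| > t] · (t + 1 - j') ≤ #slice_{j'} · C(n,2) p`.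
-/

set_option linter.dupNamespace false

noncomputable section

namespace Summit.PneNP.PneNP.Theorems.ShallowSliceBound

open Finset Literature.Computability.Complexity Classical
open Summit.PneNP.PneNP.Theorems.ConstantBand.Negative (Edge slice)
open Summit.PneNP.PneNP.Cruxes.ConstantBand.FlatPriorRelativeMinterms (ts_mem_slice ts_card_slice_pos)
open Literature.Combinatorics.SetFamily (finsetEquivFun mem_finsetEquivFun_symm)

variable {n : ℕ}

/-! ### The cylinder sum -/

/-- For `H ⊆ z`: `#{e : ¬H e, z e} + |H| = |z|`. [folklore] -/
theorem card_filter_not_and_add (H z : Edge n → Bool) (hle : ∀ e, H e = true → z e = true) :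
    #(univ.filter fun e : Edge n => ¬ H e = true ∧ z e = true) + edgeCount H = edgeCount z := by
  unfold edgeCount
  rw [← card_union_of_disjoint]
  · congr 1
    ext e
    simp only [mem_union, mem_filter, mem_univ, true_and]
    constructor
    · rintro (⟨_, hz⟩ | hH)
      · exact hz
      · exact hle e hH
    · intro hz
      by_cases hH : H e = true
      · exact Or.inr hH
      · exact Or.inl ⟨hH, hz⟩
  · rw [disjoint_left]
    intro e h1 h2
    rw [mem_filter] at h1 h2
    exact h1.2.1 h2.2

/-- For `H ⊆ z`: `#{e : ¬H e, z e} = |z| - |H|`. [folklore] -/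
theorem card_filter_not_and (H z : Edge n → Bool) (hle : ∀ e, H e = true → z e = true) :
    #(univ.filter fun e : Edge n => ¬ H e = true ∧ z e = true) = edgeCount z - edgeCount H := by
  have := card_filter_not_and_add H z hle
  omega

/-- For `H ⊆ z`: `#{e : ¬H e, ¬z e} = C(n,2) - |z|`. [folklore] -/
theorem card_filter_not_and_not (H z : Edge n → Bool) (hle : ∀ e, H e = true → z e = true) :
    #(univ.filter fun e : Edge n => ¬ H e = true ∧ ¬ z e = true) = n.choose 2 - edgeCount z := by
  rw [← card_filter_eq_false z]
  congr 1
  refine filter_congr fun e _ => ⟨fun h => h.2, fun h => ⟨fun hH => h (hle e hH), h⟩⟩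

/-- **The cylinder sum**: for fixed `H, z`,
`Σ_y [H ⊔ y = z] Pr[G(n,p) = y] = [H ⊆ z] · p^{|z| - |H|} (1-p)^{C(n,2) - |z|}` (the edges of `H` are free, the others
are prescribed by `z`). [folklore] -/
theorem sum_gnpWeight_sup_eq (p : ℝ) (H z : Edge n → Bool) :
    ∑ y : Edge n → Bool, (if H ⊔ y = z then gnpWeight n p y else 0) =
      if (∀ e, H e = true → z e = true) then
        p ^ (edgeCount z - edgeCount H) * (1 - p) ^ (n.choose 2 - edgeCount z) else 0 := by
  -- write the indicator as a product of coordinate indicators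
  have key : ∀ y : Edge n → Bool, (if H ⊔ y = z then gnpWeight n p y else 0) =
      ∏ e, ((if y e = true then p else 1 - p) * (if (H e || y e) = z e then 1 else 0)) := by
    intro y
    rw [prod_mul_distrib, ← gnpWeight_eq_prod]
    split_ifs with h
    · rw [prod_eq_one, mul_one]
      intro e _
      have := congrFun h e
      rw [sup_apply_bool] at this
      rw [if_pos this]
    · have : ∃ e, (H e || y e) ≠ z e := by
        by_contra hne
        push Not at hne
        exact h (funext fun e => by rw [sup_apply_bool]; exact hne e)
      obtain ⟨e, he⟩ := this
      rw [prod_eq_zero (mem_univ e), mul_zero]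
      rw [if_neg he]
  simp_rw [key]
  rw [sum_boolVec_prod (fun e b => (if b = true then p else 1 - p) * (if (H e || b) = z e then (1 : ℝ) else 0))]
  -- evaluate the coordinate factors
  trans ∏ e : Edge n, (if H e = true then (if z e = true then (1 : ℝ) else 0) else (if z e = true then p else 1 - p))
  · refine prod_congr rfl fun e _ => ?_
    rcases Bool.eq_false_or_eq_true (H e) with h | h <;> rcases Bool.eq_false_or_eq_true (z e) with h' | h' <;>
      simp [h, h']
  split_ifs with hle
  · have h1 : ∏ e : Edge n, (if H e = true then (if z e = true then (1 : ℝ) else 0) else (if z e = true then p else 1 - p)) =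
        ∏ e : Edge n, (if H e = true then (1 : ℝ) else (if z e = true then p else 1 - p)) := by
      refine prod_congr rfl fun e _ => ?_
      by_cases hH : H e = true
      · simp [hH, hle e hH]
      · simp [hH]
    rw [h1, prod_ite, prod_const_one, one_mul, prod_ite, prod_const, prod_const, filter_filter, filter_filter,
      card_filter_not_and H z hle, card_filter_not_and_not H z hle]
  · push Not at hle
    obtain ⟨e, hHe, hze⟩ := hle
    refine prod_eq_zero (mem_univ e) ?_
    rw [if_pos hHe, if_neg hze]

/-- `#{H ∈ slice_{j'} : H ⊆ z} = C(|z|, j')` (the `j'`-subsets of the support of `z`). [folklore] -/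
theorem card_slice_filter_subset_eq (j' : ℕ) (z : Edge n → Bool) :
    #((slice n j').filter fun H : Edge n → Bool => ∀ e, H e = true → z e = true) = (edgeCount z).choose j' := by
  have hz : edgeCount z = #(finsetEquivFun.symm z) := rfl
  rw [hz, ← card_powersetCard]
  refine card_equiv (finsetEquivFun (α := Edge n)).symm fun H => ?_
  simp only [mem_filter, ts_mem_slice, mem_powersetCard, Finset.subset_iff, mem_finsetEquivFun_symm]
  have hH : edgeCount H = #(finsetEquivFun.symm H) := rfl
  rw [hH]
  tauto

/-! ### The law of `H ⊔ G(n,p)` -/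

/-- **`H ⊔ G(n,p)` is a mixture of uniform slices**: for `H` summed over the slice `j'` and `y` weighted by `G(n,p)`,
`Σ_{H ∈ slice_{j'}} Σ_y Pr[y] · F(H ⊔ y) = Σ_z F(z) · C(|z|, j') · p^{|z| - j'} (1-p)^{C(n,2) - |z|}` for every `F`.
[folklore] -/
theorem sum_slice_sum_gnpWeight_sup (p : ℝ) (j' : ℕ) (F : (Edge n → Bool) → ℝ) :
    ∑ H ∈ slice n j', ∑ y : Edge n → Bool, gnpWeight n p y * F (H ⊔ y) =
      ∑ z : Edge n → Bool, F z * (((edgeCount z).choose j' : ℝ) * p ^ (edgeCount z - j') *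
        (1 - p) ^ (n.choose 2 - edgeCount z)) := by
  -- insert `Σ_z [H ⊔ y = z]`
  have h1 : ∀ H : Edge n → Bool, ∑ y : Edge n → Bool, gnpWeight n p y * F (H ⊔ y) =
      ∑ z : Edge n → Bool, F z * ∑ y : Edge n → Bool, (if H ⊔ y = z then gnpWeight n p y else 0) := by
    intro H
    simp_rw [mul_sum]
    rw [sum_comm]
    refine sum_congr rfl fun y _ => ?_
    rw [Fintype.sum_eq_single (H ⊔ y)]
    · simp [mul_comm]
    · intro z hz; rw [if_neg (Ne.symm hz), mul_zero]
  simp_rw [h1, sum_gnpWeight_sup_eq]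
  rw [sum_comm]
  refine sum_congr rfl fun z _ => ?_
  rw [← mul_sum]
  congr 1
  rw [← sum_filter]
  have : ∀ H ∈ (slice n j').filter (fun H : Edge n → Bool => ∀ e, H e = true → z e = true),
      p ^ (edgeCount z - edgeCount H) * (1 - p) ^ (n.choose 2 - edgeCount z) =
        p ^ (edgeCount z - j') * (1 - p) ^ (n.choose 2 - edgeCount z) := by
    intro H hH
    rw [mem_filter, ts_mem_slice] at hH
    rw [hH.1]
  rw [sum_congr rfl this, sum_const, card_slice_filter_subset_eq, nsmul_eq_mul]
  ring

/-- The total mass: `Σ_z C(|z|, j') p^{|z|-j'} (1-p)^{C(n,2)-|z|} = #slice_{j'}`. [folklore] -/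
theorem sum_choose_mul_pow_eq_card_slice (p : ℝ) (j' : ℕ) :
    ∑ z : Edge n → Bool, ((edgeCount z).choose j' : ℝ) * p ^ (edgeCount z - j') * (1 - p) ^ (n.choose 2 - edgeCount z) =
      #(slice n j') := by
  have h := sum_slice_sum_gnpWeight_sup p j' (fun _ => (1 : ℝ)) (n := n)
  simp only [mul_one, one_mul, sum_gnpWeight, sum_const, nsmul_eq_mul] at h
  exact h.symm

/-! ### Markov for the number of sprinkled edges -/

/-- `E[e(G(n,p))] = C(n,2) p` as a finite sum. [folklore] -/
theorem sum_gnpWeight_mul_edgeCount (p : ℝ) :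
    ∑ y : Edge n → Bool, gnpWeight n p y * edgeCount y = n.choose 2 * p := by
  have h1 : ∀ y : Edge n → Bool, (edgeCount y : ℝ) = ∑ e : Edge n, if y e = true then (1 : ℝ) else 0 := by
    intro y; rw [edgeCount, card_eq_sum_ones, Nat.cast_sum, sum_filter]; simp
  simp_rw [h1, mul_sum]
  rw [sum_comm]
  have h2 : ∀ e : Edge n, ∑ y : Edge n → Bool, gnpWeight n p y * (if y e = true then (1 : ℝ) else 0) = p := by
    intro e
    have := sum_gnpWeight_filter_forall p ({e} : Finset (Edge n)) (n := n)
    rw [card_singleton, pow_one, sum_filter] at this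
    refine Eq.trans (sum_congr rfl fun y _ => ?_) this
    by_cases hy : y e = true <;> simp [hy]
  simp_rw [h2]
  rw [sum_const, card_univ, card_edgeSet_top_fin, nsmul_eq_mul]

/-- `|H ⊔ y| ≤ |H| + |y|`. [folklore] -/
theorem edgeCount_sup_le (H y : Edge n → Bool) : edgeCount (H ⊔ y) ≤ edgeCount H + edgeCount y := by
  rw [edgeCount, edgeCount, edgeCount]
  refine (card_le_card ?_).trans (card_union_le _ _)
  intro e he
  rw [mem_filter, sup_apply_bool, Bool.or_eq_true] at he
  rw [mem_union, mem_filter, mem_filter]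
  tauto

/-- **Markov tail for the sprinkle**: for `0 ≤ p ≤ 1` and `j' ≤ t`,
`(t + 1 - j') · Σ_{H ∈ slice_{j'}} Pr_y[|H ⊔ y| > t] ≤ #slice_{j'} · C(n,2) p`. [folklore] -/
theorem sum_slice_gnpWeight_edgeCount_sup_gt_le {p : ℝ} (hp0 : 0 ≤ p) (hp1 : p ≤ 1) {j' t : ℕ} (hjt : j' ≤ t) :
    ((t : ℝ) + 1 - j') * ∑ H ∈ slice n j', ∑ y ∈ univ.filter (fun y : Edge n → Bool => t < edgeCount (H ⊔ y)),
        gnpWeight n p y ≤ #(slice n j') * (n.choose 2 * p) := by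
  have hw := fun y : Edge n → Bool => gnpWeight_nonneg hp0 hp1 y
  -- per `H`: `(t+1-j') Pr[|H ⊔ y| > t] ≤ (t+1-j') Pr[|y| ≥ t+1-j'] ≤ E|y| = N p`
  have hH : ∀ H ∈ slice n j', ((t : ℝ) + 1 - j') *
      ∑ y ∈ univ.filter (fun y : Edge n → Bool => t < edgeCount (H ⊔ y)), gnpWeight n p y ≤ n.choose 2 * p := by
    intro H hHs
    rw [ts_mem_slice] at hHs
    have hsub : (univ.filter fun y : Edge n → Bool => t < edgeCount (H ⊔ y)) ⊆
        univ.filter fun y : Edge n → Bool => t + 1 - j' ≤ edgeCount y := by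
      intro y hy
      rw [mem_filter] at hy ⊢
      have := edgeCount_sup_le H y
      rw [hHs] at this
      exact ⟨mem_univ _, by omega⟩
    calc ((t : ℝ) + 1 - j') * ∑ y ∈ univ.filter (fun y : Edge n → Bool => t < edgeCount (H ⊔ y)), gnpWeight n p y
        ≤ ((t : ℝ) + 1 - j') * ∑ y ∈ univ.filter (fun y : Edge n → Bool => t + 1 - j' ≤ edgeCount y), gnpWeight n p y := by
          refine mul_le_mul_of_nonneg_left (sum_le_sum_of_subset_of_nonneg hsub fun y _ _ => hw y) ?_
          have : (j' : ℝ) ≤ t := by exact_mod_cast hjt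
          linarith
      _ = ∑ y ∈ univ.filter (fun y : Edge n → Bool => t + 1 - j' ≤ edgeCount y), ((t + 1 - j' : ℕ) : ℝ) * gnpWeight n p y := by
          rw [mul_sum]; refine sum_congr rfl fun y _ => ?_
          rw [Nat.cast_sub (by omega), Nat.cast_add, Nat.cast_one]
      _ ≤ ∑ y ∈ univ.filter (fun y : Edge n → Bool => t + 1 - j' ≤ edgeCount y), gnpWeight n p y * edgeCount y := by
          refine sum_le_sum fun y hy => ?_
          rw [mem_filter] at hy
          rw [mul_comm]
          exact mul_le_mul_of_nonneg_left (by exact_mod_cast hy.2) (hw y)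
      _ ≤ ∑ y : Edge n → Bool, gnpWeight n p y * edgeCount y :=
          sum_le_sum_of_subset_of_nonneg (filter_subset _ _) fun y _ _ => mul_nonneg (hw y) (Nat.cast_nonneg _)
      _ = n.choose 2 * p := sum_gnpWeight_mul_edgeCount p
  calc ((t : ℝ) + 1 - j') * ∑ H ∈ slice n j', ∑ y ∈ univ.filter (fun y : Edge n → Bool => t < edgeCount (H ⊔ y)),
        gnpWeight n p y
      = ∑ H ∈ slice n j', ((t : ℝ) + 1 - j') *
          ∑ y ∈ univ.filter (fun y : Edge n → Bool => t < edgeCount (H ⊔ y)), gnpWeight n p y := by rw [mul_sum]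
    _ ≤ ∑ _H ∈ slice n j', (n.choose 2 : ℝ) * p := sum_le_sum hH
    _ = #(slice n j') * (n.choose 2 * p) := by rw [sum_const, nsmul_eq_mul]

/-- **Registered form** (sub-goal `sprinkle_law` of stmt-PneNP-14083): the law of `H ⊔ G(n,p)` for `H` on a slice,
all binders explicit. [folklore] -/
theorem sprinkle_law :
    ∀ (n : ℕ) (p : ℝ) (j' : ℕ) (F : (Edge n → Bool) → ℝ),
      ∑ H ∈ slice n j', ∑ y : Edge n → Bool, gnpWeight n p y * F (H ⊔ y) =
      ∑ z : Edge n → Bool, F z * (((edgeCount z).choose j' : ℝ) * p ^ (edgeCount z - j') *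
        (1 - p) ^ (n.choose 2 - edgeCount z)) :=
  fun _ p j' F => sum_slice_sum_gnpWeight_sup p j' F

end Summit.PneNP.PneNP.Theorems.ShallowSliceBound

end
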